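import Mathlib
import HarnessLib
import HarnessLib.Audit
import Summits.Langlands.Statement
import Literature.NumberTheory.GaloisRepresentations.HeckeCharacter
import Literature.NumberTheory.GaloisRepresentations.LAdicRepFrobenius
import Literature.NumberTheory.Automorphic.PairLFunctionBaseChange

/-!
Route: ReducibleSelfDual

CLOSED (retired) 2026-08-15T13:48:44Z by operator:999:1257524 — reason: not-a-thesis: assembly does not conclude the sub-problem Statement — note: D-0027 §2.1 audit (human 2026-08-15: routes that do not decide the summit are removed): the assembly concludes `IrreducibleGL3`, not the sub-problem statement; a NEW conforming route may be opened from the same idea (generated `closes : … → _root_.Langlands`).. The file is kept as the record of this route; refuted decls are indexed as negative knowledge (`ledger negatives`).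

# Route ReducibleSelfDual — reducibility forces essential self-duality; ess. self-dual GL3 over CM
is an adjoint lift, so rho_(pi,iota) is irreducible at every iota

Target T (route-local, a conjunct-level contribution to direction (A)
`Summit.Langlands.AutomorphicToGalois 3` over CM fields): for K totally
real or CM, pi a regular algebraic cuspidal automorphic representation of GL_3(A_K), and every (l,
iota), EVERY semisimple r : Gal_K -> GL_3(Qbar_l)
carrying the lang.S27 Satake-Frobenius compatibility of
`Literature.NumberTheory.Automorphic.exists_galoisRep_of_regularAlgebraic` (i.e. r = rho_(pi,iota)
of HLTT/Scholze/Varma) is IRREDUCIBLE. It suffices to show X = X1 ∧ X2 (card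
reducibility-forces-selfduality, Steps 0-3 = X2, Step 4 = X1):
X2 (ReducibleForcesEssSelfDual, TR or CM): if such an r is reducible then pi is essentially
self-dual — at Satake level, there is a Hecke character eta with
multiset(alpha_v^-1) = eta(varpi_v) * alpha_v for almost all v; X1 (EssSelfDualIrreducible, CM): an
essentially self-dual regular algebraic cuspidal pi on
GL_3 over a CM field has r irreducible, because pi = Ad(sigma) x nu with sigma regular algebraic
cuspidal on GL_2/K (SelfDualGL3IsAdjointLift) and
r = Ad0(r_sigma) x nu_l can only degenerate if r_sigma is reducible or imprimitive, both excluded by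
cuspidality. The totally real half of T is
Böckle–Hui Thm 1.2 (support IrreducibleGL3TotallyReal); the two external printed inputs are inlined
as antecedents and filed as items
(AbelianSummandIsHecke = BH Thm 1.1 + Clozel + Serre/Henniart dictionary; SelfDualGL3IsAdjointLift =
GRS/Ramakrishnan + archimedean bookkeeping over CM).
Lean: `EssSelfDualIrreducible ∧ ReducibleForcesEssSelfDual` where the target T is `∀ (K : Type)
[Field K] [NumberField K], (NumberField.IsTotallyReal K ∨ NumberField.IsCMField K) → ∀ (hcpt :
Literature.NumberTheory.Automorphic.isCompact_glFiniteIntegralLevel 3 K) (π :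
Literature.NumberTheory.Automorphic.CuspidalAutomorphicRepData 3 K hcpt), π.1.IsRegularAlgebraic → ∀
(ℓ : ℕ) [Fact ℓ.Prime] (ι : PadicAlgCl ℓ ≃+* ℂ) (r :
Literature.NumberTheory.GaloisRepresentations.FramedGaloisRep K (PadicAlgCl ℓ) 3),
r.toGaloisRep.IsSemisimple → (∀ (v : IsDedekindDomain.HeightOneSpectrum (NumberField.RingOfIntegers
K)) (α : Multiset ℂ), π.1.HasSatakeParamAt v α → ((ℓ : ℕ) : NumberField.RingOfIntegers K) ∉
v.asIdeal → r.IsUnramifiedAt v ∧ r.HasFrobCharpolyAt v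
(Literature.NumberTheory.Automorphic.arithFrobPolyOfSatake ι v.residueCard 3 α)) →
r.toGaloisRep.IsIrreducible`

## Assembly
Pure logic (checked sorry-free in the planner's Sketch.lean): fix K, split `IsTotallyReal K ∨
IsCMField K`; the totally real case is the support item;
in the CM case, if r were not irreducible, ReducibleForcesEssSelfDual (fed with the dictionary
input) makes pi essentially self-dual and
EssSelfDualIrreducible (fed with lang.S27, Chebotarev and both inputs) makes r irreducible —
contradiction. The two in-tree named facts and the two
input items are the leading antecedents, exactly as they appear inlined inside the cruxes.

Rationale: WHY THIS LINE. The (A)-clause of the summit asks for rho_(pi,iota) IRREDUCIBLE at every iota; for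
non-polarizable pi over CM fields this is open already for n = 3
(Dai arXiv:2510.12496, intro: n = 3 over CM only in the polarized case [BR92]; n = 3 over totally
real fields is Böckle–Hui arXiv:2404.08954 Thm 1.2).
Mechanism (card reducibility-forces-selfduality): BH §3.2.1 READ — the L-function identity 1 +
Alt2(rho) x tau^-2 = rho x tau^-1 + det(sigma) tau^-2 with
Jacquet–Shalika poles forces "reducible => essentially self-dual" over ANY field once the abelian
summand is an algebraic Hecke character (BH Thm 1.1, any K);
totally real enters BH's proof ONLY in the last line [Hu23a] (ess. self-dual => irreducible via
polarizability + potential automorphy), which is unavailable over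
CM because pi^v = pi x eta is not pi^(c,v) = pi x eta there. The route replaces that last line by
representation theory one rank down: an essentially
self-dual cuspidal GL_3 form is a twist of an adjoint (Gelbart–Jacquet) lift from GL_2 (Ramakrishnan
doi:10.1007/s13226-014-0088-1; arXiv:2502.10799
Lem 4.7), the GL_2 form can be made regular algebraic over CM (but NOT over totally real fields:
mixed parity, Patrikis arXiv:1207.6724), HLTT gives
r_sigma, and Ad0(r_sigma) is reducible only for reducible or imprimitive r_sigma — both contradict
cuspidality. Imported areas: analytic theory of
Rankin–Selberg/standard L-functions (poles on Re s = 1), Lie-theoretic image arguments (SO_3 =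
PGL_2), no geometry and no lifting theorems — which is
why it survives for non-polarizable pi. No prior route exists on this summit; negatives index empty.

RANKED CRUXES. #0 IrreducibleGL3 (target) — for K totally real or CM, pi regular algebraic cuspidal
on GL_3(A_K), l, iota, every semisimple r : Gal_K -> GL_3(Qbar_l) unramified with
arithmetic-Frobenius charpoly arithFrobPolyOfSatake iota q_v 3 alpha_v at every v not dividing l
where pi has Satake parameter alpha_v (lang.S27 normalisation) is irreducible. (why it might fail:
False only if some RA cuspidal pi on GL3 over a CM field has rho_{pi,iota} reducible at some iota
(conjecturally never, Ramakrishnan); TR half is BH Thm 1.2. As typed it silently leans on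
hasSatakeParamAt_cofinite: a datum with finitely many Satake places would leave r unconstrained.)
[arXiv:2404.08954, arXiv:math/0609460, arXiv:2510.12496, HarrisLanTaylorThorneRMS2016, VarmaFMS2024]
#2 EssSelfDualIrreducible (crux) — (card R1 / Step 4, the delta) given lang.S27 (for r_sigma on
GL_2), Chebotarev, the BH/Serre dictionary input (text of AbelianSummandIsHecke) and the
adjoint-lift input (text of SelfDualGL3IsAdjointLift): for K a CM field, pi regular algebraic
cuspidal on GL_3(A_K) that is essentially self-dual at Satake level (exists Hecke eta, a.e. v:
alpha_v^-1 = eta(varpi_v) alpha_v as multisets), every semisimple lang.S27-compatible r is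
irreducible. Proof line: r and Ad0(r_sigma) x nu_l have equal Frobenius charpolys a.e. => isomorphic
(Chebotarev + Brauer–Nesbitt, in tree); r_sigma irreducible (else chi1 + chi2 algebraic Hecke by the
dictionary input, contradicting cuspidality of sigma via JS); Ad0 of an irreducible 2-dim rep is
reducible iff r_sigma = r_sigma x chi_L, chi_L quadratic, and then Ad(sigma) = chi_L +
AI(theta/theta^c) is not cuspidal (JS), contradiction. Expected in-tree analytic/class-field inputs
(JS pole facts for GL_2 x GL_1 and GL_3 x GL_1, quadratic class-field characters, W/W' <-> L2
bridges) are to be added as `(h : Fact) ->` antecedents on the prover's request (tenure restate),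
mirrored in the Assembly. [deps: SelfDualGL3IsAdjointLift, AbelianSummandIsHecke] [difficulty: L]
(why it might fail: Needs r_sigma irreducible for RA cuspidal GL2 over CM at EVERY iota (reducible
chi1+chi2 excluded only via the BH/Serre input + JS poles) and the imprimitive case sigma = sigma x
chi_L killed by cuspidality of Ad(sigma); building Ad0(r_sigma) as a framed rep + matching charpolys
is unbuilt plumbing.) [arXiv:2404.08954, arXiv:2510.12496, HarrisLanTaylorThorneRMS2016,
doi:10.1007/s13226-014-0088-1, Gelbart–Jacquet Ann. Sci. ENS 11 (1978), Taylor Invent. Math. 116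
(1994) (GL2 over imaginary quadratic fields II, irreducibility), JacquetShalikaAJM1981]
#3 ReducibleForcesEssSelfDual (crux) — (card Steps 0-3 = BH §3.2.1 / Calegari Rem 3.1, made
field-independent) given the dictionary input (text of AbelianSummandIsHecke): for K totally real or
CM, pi regular algebraic cuspidal on GL_3(A_K), l, iota, r semisimple lang.S27-compatible and NOT
irreducible, pi is essentially self-dual at Satake level: exists a Hecke character eta with, for
almost all v and the Satake parameter alpha_v, eta unramified at v and alpha_v.map inv = alpha_v.map
(eta(varpi_v) * .). Proof line: r = tau + sigma, tau = algebraic Hecke chi (input), JS bounds pin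
the weight of chi (Step 0), then zeta(s) L(s, pi^v x omega chi^-2 ...) = L(s, pi x chi^-1 ...) L(s,
mu chi^-2) at the unitary edge forces det sigma = tau^2, i.e. r^v = r x tau^-2, read off on Satake
parameters. Expected in-tree analytic inputs (to be added as `(h : Fact) ->` antecedents on the
prover's request): JacquetShalika1981_partialPairL_at_one_of_rank_ne / _of_ne_conj /
_pole_of_eq_conj, norm_satakeParameter_le_sqrt, heckeLFunction continuation facts,
exists_isAssociatedL2, hasSatakeParamAt_iff_L2. [deps: AbelianSummandIsHecke] [difficulty: L] (why
it might fail: BH 3.2.1 is field-independent but evaluates L(Alt2 pi x psi1,1) != 0 and L(psi3,1)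
finite at the unitary edge; over CM with odd motivic weight no algebraic unitary twist exists, so
the summand-weight bookkeeping (card Step 0: JS bounds pin |tau(Frob)| = q^-1) must be redone or the
pole count shifts.) [arXiv:2404.08954, arXiv:math/0609460, JacquetShalikaAJM1981,
JacquetShalikaAJM1981II, ArthurClozelAMS120, Clozel1990]
#4 SelfDualGL3IsAdjointLift (crux) — (card R1(a)+(b)) for K a CM field and pi regular algebraic
cuspidal on GL_3(A_K) essentially self-dual at Satake level, there are a REGULAR ALGEBRAIC cuspidal
sigma on GL_2(A_K) and an ALGEBRAIC Hecke character nu with, for almost all v and Satake parameters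
alpha_v of pi, beta_v = (a,b) of sigma: nu unramified at v and alpha_v + (nu(varpi_v)) = nu(varpi_v)
* (beta_v tensor beta_v^-1) as multisets (i.e. alpha_v = nu(varpi_v)(a/b, 1, b/a)). Proof line:
eta^3 = omega^-2 makes eta a square, so a twist of pi is self-dual with trivial central character;
L(s, Sym2) has the pole; GRS descent to SL_2 + Labesse–Langlands + Gelbart–Jacquet give pi =
Ad(sigma0) x nu0 (Ramakrishnan 2014; arXiv:2502.10799 Lem 4.7); purity of pi forces sigma0,w
tempered with characters (z/|z|)^(m_j) |z|^(i theta_w), m_1 = m_2 mod 2; twisting by a unitary Hecke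
character with infinity type |.|^(i theta_w) (admissible because omega_sigma0 is a Hecke character)
and by one with infinity type (z/|z|)^(e_w) (admissible over CM: trivial on totally positive units
of K+) makes sigma regular algebraic; nu is then integral at every place, hence algebraic.
[difficulty: M] (why it might fail: pi ~ Ad(sigma0) x nu holds over any K (Ramakrishnan 2014);
making sigma0 REGULAR ALGEBRAIC needs a global twist of prescribed half-integral parity at each
complex place: exists over CM via (z/|z|)^e, FAILS over totally real K (mixed-parity Hilbert forms,
Patrikis); a CM analogue would refute it.) [doi:10.1007/s13226-014-0088-1, arXiv:2502.10799,
Ginzburg–Rallis–Soudry Ann. of Math. 150 (1999) (descent GL_2n+1 -> Sp_2n), Labesse–Langlands Canad.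
J. Math. 31 (1979), Gelbart–Jacquet Ann. Sci. ENS 11 (1978), arXiv:1207.6724, Clozel1990]
#9 AbelianSummandIsHecke (support) — (printed inputs, transcription) for K totally real or CM, pi
regular algebraic cuspidal on GL_n(A_K), l, iota, r semisimple lang.S27-compatible, every character
tau occurring on an r-stable line is the iota-avatar of an ALGEBRAIC Hecke character chi: for almost
all v, chi and tau are unramified and tau(Frob_v^arith) = iota^-1(chi(varpi_v))^-1 (=
arithFrobPolyOfSatake iota q_v 1 (chi(varpi_v))). = Clozel Thm 3.13 (E-rationality of pi_f) +
HLTT/Varma (lg) + Böckle–Hui Thm 1.1 (weak abelian direct summands of E-rational semisimple reps are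
locally algebraic, ANY number field K) + Serre Ch. III / Henniart (locally algebraic abelian <=>
algebraic Hecke). To be vendored as Literature named facts and instantiated. [difficulty: M]
[arXiv:2404.08954, Clozel1990, SerreAbelianLadic1968, Henniart 1982 (Représentations l-adiques
abéliennes, Sém. Théorie des Nombres Paris), HarrisLanTaylorThorneRMS2016, VarmaFMS2024]
#9 IrreducibleGL3TotallyReal (support) — the totally real half of the target: Böckle–Hui Thm 1.2
verbatim (K totally real, pi RA cuspidal on GL_3, every iota: rho_(pi,iota) irreducible),
transported to every semisimple lang.S27-compatible r by Chebotarev + Brauer–Nesbitt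
(FramedGaloisRep.nonempty_equiv_of_hasFrobCharpolyAt_eventually). Known; to be vendored as a named
fact. [difficulty: provable-now] [arXiv:2404.08954, doi:10.1007/s00208-025-03252-0]

TWO-LAYER PLAN. Foreseen glued splits (k <= 3, depth 1), filed only after a crux closes or a prover
asks: EssSelfDualIrreducible <= GL2IrreducibleCM (r_sigma irreducible
for RA cuspidal GL_2 over CM, all iota) -> AdjointImprimitivityDichotomy (pure rep theory: Ad0(s)
reducible, s irreducible 2-dim => s = s x chi, chi
quadratic) -> EssSelfDualIrreducible; ReducibleForcesEssSelfDual <= SummandWeightZero (Step 0) ->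
PoleIdentityForcesDetSquare (Steps 1-2) ->
ReducibleForcesEssSelfDual; SelfDualGL3IsAdjointLift <= SelfDualGL3Classification (any K, sigma0
merely cuspidal) -> RegularAlgebraicTwistCM ->
SelfDualGL3IsAdjointLift. Restating cruxes with explicit `(h : <in-tree JS fact>) ->` antecedents is
expected at the first prover engagement.

KILL CRITERIA. A RA cuspidal essentially self-dual pi on GL_3 over a CM field with NO regular
algebraic sigma (a CM analogue of mixed-parity Hilbert forms) refutes
SelfDualGL3IsAdjointLift and forces a pivot of EssSelfDualIrreducible to Hui-style algebraic
envelopes (or closes the route if none applies over CM).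
A reducible rho_(pi,iota) for some RA cuspidal GL_3 pi over a CM field refutes the target outright
(close refuted:IrreducibleGL3). If
ReducibleForcesEssSelfDual is refuted AS TYPED (normalisation slip in the Satake-level rendering of
pi^v = pi x eta), restate, do not close.
If a Literature fact lands proving irreducibility for GL_3 over CM at all iota (e.g. a sequel of
arXiv:2404.08954), the route is superseded/known.

NOT DECOMPOSED YET. The analytic sub-steps of ReducibleForcesEssSelfDual (which in-tree JS/GJ named
facts, the W/W' <-> L2 bridges, unitary twisting) — the prover names
the exact `(h : Fact) ->` prefix; the construction of Ad0(r_sigma) as a FramedGaloisRep and the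
imprimitivity lemma (layer-2 children of
EssSelfDualIrreducible); the glue from the target to the literal irreducibility conjunct of
`AutomorphicToGalois 3` (m = 3 vs m = 1 normalisation =
cyclotomic twist; L-algebraic + regular = regular algebraic for n odd); the n = 4
tensor-decomposability rigidity and the card's decision procedure
(R2, R3) — a follow-up route once X2's bookkeeping is in Lean.

CHEAPEST FALSIFIER. (i) Run the pole bookkeeping of ReducibleForcesEssSelfDual on a NON-cuspidal
isobaric sigma + chi (must NOT yield a contradiction: P(pi x pi^v) = 2)
— an hour by hand; (ii) literature lookup: does any 2025-26 paper (sequel to arXiv:2404.08954,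
arXiv:2603.19768 'should work over any number
field', arXiv:2502.10799) already state GL_3 over CM at all iota? Searched today (see Novelty): no;
(iii) check the unit-theorem step of
SelfDualGL3IsAdjointLift on K = Q(i) x real quadratic (degree-4 CM field with unit of infinite
order): the parity twist (z/|z|)^(e_w) must be
trivial on a finite-index subgroup of O_K^x — it is (real units have argument 0 or pi).

NUMBERS. n = 3; fields: CM (new) and totally real (BH Thm 1.2, 2025); known CM cases before:
polarized only [BR92]; density-one sets of iota: PT15/FW25;
items at open: 7 (1 target, 3 cruxes, 2 support, 1 assembly).

DEFINITION REQUESTS. None blocking: HeckeCharacter (IsAlgebraic, IsUnramifiedAt,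
valueAtUniformizer), FramedGaloisRep (IsUnramifiedAt, HasFrobCharpolyAt, IsSemisimple,
IsIrreducible), CuspidalAutomorphicRepData (HasSatakeParamAt, IsRegularAlgebraic),
arithFrobPolyOfSatake, satakeTensor all exist. Cite facts wanted
(to be filed by provers as Literature named facts): Böckle–Hui Thm 1.1; Clozel 1990 Thm 3.13;
Serre/Henniart locally-algebraic <=> Hecke dictionary;
Ramakrishnan 2014 / GRS self-dual GL_3 classification; Labesse–Langlands; Gelbart–Jacquet adjoint
lift with its cuspidality criterion; BH Thm 1.2.
Acquisition filed: acq-02102 (Ramakrishnan 2014, paywalled).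

Novelty: Searches (2026-08-15): `lit read arxiv:2404.08954` pp.3-4, 13-14 (Thm 1.1 any K; Thm 1.2 TR; §3.2.1
TR only via [Hu23a]; Rem 3.1); `lit read arxiv:2510.12496` p.3
(state of the art Oct 2025: n=3 CM only polarized [BR92], n=3 TR [BH25]); `lit frontier Langlands
--since 2023` (30 rows; relevant: arXiv:2603.19768 GL(4) TR,
arXiv:2502.10799 image of GL_3 reps TR — READ p.14: Lem 4.7 ess. self-dual GL_3 <=> essentially
sym^2 via Ramakrishnan 2014); `lit bridges Langlands --cross any`
(nothing relevant); `lit search --hybrid "irreducibility automorphic Galois representations GL(3) CM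
field essentially self-dual"` (10 textbook hits only);
`lit search --source zbmath "selfdual cusp forms GL(3) Ramakrishnan"` (1:
doi:10.1007/s13226-014-0088-1, paywalled, acq-02102); galaxy/arXiv/OpenAlex/S2
unavailable (rate-limited / queue) at filing; refuter novelty audit of the card (2026-08-15) read BH
full text + Dai + zbMATH 25 rows 2012-: none CM non-polarizable n=3.
Nearest prior art found: arXiv:2404.08954 (Böckle–Hui, Math. Ann. 2025) §3.2.1 + Rem 3.1 = crux
ReducibleForcesEssSelfDual in substance (TR stated, field-independent
up to the last line); [Hu23a]/arXiv:1104.4827 (ess. self-dual over TR); [BR92] (polarized n=3 over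
CM); arXiv:2502.10799 Lem 4.7 (classification step of
SelfDualGL3IsAdjointLift, TR paper).
Delta: closing 'essentially self-dual => irreducible' over CM fields by the adjoint-lift
classification + regular-algebraic retwisting of the GL_2 form (possible
over CM, impossible  [refs: 10.1007/s13226-014-0088-1, 2404.08954, 2510.12496, 2603.19768, 2502.10799, 1104.4827, arxiv:2404.08954, arxiv:2510.12496, doi:10.1007/s13226-014-0088-1]

Barriers (technique_class: rankin-selberg l-function-poles, adjoint-lift gl2-to-gl3): - technique_class: rankin-selberg l-function-poles, adjoint-lift gl2-to-gl3
- Literature.Barriers.Langlands.TwistedEndoscopySelfDual: used in reverse and only where printed —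
the route PROVES that a reducible avatar forces pi into the theta-stable (essentially self-dual)
locus and then uses the known GL_3 <-> SO_3 = PGL_2 descent (GRS/Ramakrishnan) there; no
functoriality for non-self-dual pi is assumed, and r for non-polarizable pi comes from the in-tree
fact exists_galoisRep_of_regularAlgebraic (HLTT/Scholze), not from endoscopy.
- Literature.Barriers.Langlands.ShimuraVarietyRealizationBarrier: evaded — nothing cohomological is
used; the argument never asks whether r is realised in the cohomology of a Shimura variety, which is
exactly why it applies to non-polarizable pi over CM fields.
- Literature.Barriers.Langlands.NonRegularWeightBarrier: not evaded, conceded: regularity is a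
standing hypothesis (needed for r to exist via HLTT and for sigma to be retwisted regular
algebraic); the pole calculus itself is weight-blind.
- Literature.Barriers.Langlands.ResiduallyReducibleBarrier: not engaged — no residual
representation, no lifting theorem, no Taylor–Wiles hypothesis appears.
- Negatives index: empty for Langlands at filing (ledger negatives --problem Langlands: 0).

History (route lifecycle, newest last):
- 2026-08-15T13:48:44Z · CLOSED retired — not-a-thesis: assembly does not conclude the sub-problem Statement (operator:999:1257524)

sub-problem: Langlands · status: closed(retired) · opened planner-plancard-Langlands-Langlands-reducibi-e4840bdc-0 2026-08-15T11:12:28Z · rev 1 · ledger route-Langlands-ReducibleSelfDual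
GENERATED by the gate from the ledger (D-0016/17). Provers cite these decls: `theorem foo : Summit.Langlands.Langlands.Theses.ReducibleSelfDual.<Decl> := …` in Summits/Langlands/Langlands/Theorems/<Name>.lean.
-/

namespace Summit.Langlands.Langlands.Theses.ReducibleSelfDual

open scoped BigOperators Topology Manifold Classical MeasureTheory ProbabilityTheory Matrix InnerProductSpace ComplexConjugate ContinuousMap
open Filter Set Function TopologicalSpace MeasureTheory

attribute [summit_statement] _root_.Langlands

/-- item stmt-Langlands-3184 · target · rank 0 · closed · moot by None · by planner
why it might fail: False only if some RA cuspidal pi on GL3 over a CM field has rho_(pi,iota) reducible at some iota: open (arXiv:2510.12496 Sec.1: n=3/CM only polarized [BR92]; arXiv:2603.19768 Sec.1). TR half = BH Thm 1.2 (fact isIrreducible_galoisRep_gl3_totallyReal). Not vacuous: hasSatakeParamAt_cofinite_holds.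
sources: arXiv:2404.08954, BockleHui2025, arXiv:2510.12496, arXiv:2603.19768, HarrisLanTaylorThorneRMS2016, VarmaFMS2024
[target] for K totally real or CM, pi regular algebraic cuspidal on GL_3(A_K), l, iota, every
semisimple r : Gal_K -> GL_3(Qbar_l) unramified with arithmetic-Frobenius charpoly
arithFrobPolyOfSatake iota q_v 3 alpha_v at every v not dividing l where pi has Satake parameter
alpha_v (lang.S27 normalisation) is irreducible. -/
@[route_item "route-Langlands-ReducibleSelfDual"]
def IrreducibleGL3 : Prop :=
  ∀ (K : Type) [Field K] [NumberField K], (NumberField.IsTotallyReal K ∨ NumberField.IsCMField K) → ∀ (hcpt : Literature.NumberTheory.Automorphic.isCompact_glFiniteIntegralLevel 3 K) (π : Literature.NumberTheory.Automorphic.CuspidalAutomorphicRepData 3 K hcpt), π.1.IsRegularAlgebraic → ∀ (ℓ : ℕ) [Fact ℓ.Prime] (ι : PadicAlgCl ℓ ≃+* ℂ) (r : Literature.NumberTheory.GaloisRepresentations.FramedGaloisRep K (PadicAlgCl ℓ) 3), r.toGaloisRep.IsSemisimple → (∀ (v : IsDedekindDomain.HeightOneSpectrum (NumberField.RingOfIntegers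 K)) (α : Multiset ℂ), π.1.HasSatakeParamAt v α → ((ℓ : ℕ) : NumberField.RingOfIntegers K) ∉ v.asIdeal → r.IsUnramifiedAt v ∧ r.HasFrobCharpolyAt v (Literature.NumberTheory.Automorphic.arithFrobPolyOfSatake ι v.residueCard 3 α)) → r.toGaloisRep.IsIrreducible

/-- item stmt-Langlands-3185 · crux · rank 2 · closed · moot by None · by planner
why it might fail: CM delta, not in print. Use only r_sigma irreducible (Henniart/BH 1.1 via n=2 dictionary + JS) and non-induced (sigma non-dihedral as pi cuspidal): strong irreducibility over CM is unavailable (Artin-up-to-twist open, ACC+ 7.1; arXiv:2603.19768 Lem 2.9 over-claims). JS/GJ/CFT facts not antecedents.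
sources: arXiv:2404.08954, BockleHui2025, AllenCalegariCaraianiGeeEtAl2023, arXiv:1812.09999, arXiv:2603.19768, JacquetShalikaAJM1981II
[crux] (card R1 / Step 4, the delta) given lang.S27 (for r_sigma on GL_2), Chebotarev, the BH/Serre
dictionary input (text of AbelianSummandIsHecke) and the adjoint-lift input (text of
SelfDualGL3IsAdjointLift): for K a CM field, pi regular algebraic cuspidal on GL_3(A_K) that is
essentially self-dual at Satake level (exists Hecke eta, a.e. v: alpha_v^-1 = eta(varpi_v) alpha_v
as multisets), every semisimple lang.S27-compatible r is irreducible. Proof line: r and Ad0(r_sigma)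
x nu_l have equal Frobenius charpolys a.e. => isomorphic (Chebotarev + Brauer–Nesbitt, in tree);
r_sigma irreducible (else chi1 + chi2 algebraic Hecke by the dictionary input, contradicting
cuspidality of sigma via JS); Ad0 of an irreducible 2-dim rep is reducible iff r_sigma = r_sigma x
chi_L, chi_L quadratic, and then Ad(sigma) = chi_L + AI(theta/theta^c) is not cuspidal (JS),
contradiction. Expected in-tree analytic/class-field inputs (JS pole facts for GL_2 x GL_1 and GL_3
x GL_1, quadratic class-field characters, W/W' <-> L2 bridges) are to be added as `(h : Fact) ->`
antecedents on the prover's request (tenure restate), mirrored in the Assembly. [deps: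
SelfDualGL3IsAdjointLift, AbelianSummandIsHecke] [di -/
@[route_item "route-Langlands-ReducibleSelfDual"]
def EssSelfDualIrreducible : Prop :=
  Literature.NumberTheory.Automorphic.exists_galoisRep_of_regularAlgebraic → Literature.NumberTheory.Automorphic.chebotarev_artinRep → (∀ (n : ℕ), ∀ (K : Type) [Field K] [NumberField K], (NumberField.IsTotallyReal K ∨ NumberField.IsCMField K) → ∀ (hcpt : Literature.NumberTheory.Automorphic.isCompact_glFiniteIntegralLevel n K) (π : Literature.NumberTheory.Automorphic.CuspidalAutomorphicRepData n K hcpt), π.1.IsRegularAlgebraic → ∀ (ℓ : ℕ) [Fact ℓ.Prime] (ι : PadicAlgCl ℓ ≃+* ℂ) (r : Literature.NumberTheory.GaloisRepresentations.FramedGaloisRep K (PadicAlgCl ℓ) n), r.toGaloisRep.IsSemisimple → (∀ (v : IsDedekindDomain.HeightOneSpectrum (NumberField.RingOfIntegers K)) (α : Multiset ℂ), π.1.HasSatakeParamAt v α → ((ℓ : ℕ) : NumberField.RingOfIntegers K) ∉ v.asIdeal → r.IsUnramifiedAt v ∧ r.HasFrobCharpolyAt v (Literature.NumberTheory.Automorphic.arithFrobPolyOfSatake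 ι v.residueCard n α)) → ∀ (τ : Literature.NumberTheory.GaloisRepresentations.FramedGaloisRep K (PadicAlgCl ℓ) 1), (∃ x : Fin n → PadicAlgCl ℓ, x ≠ 0 ∧ ∀ g : Field.absoluteGaloisGroup K, r.toGaloisRep g x = ((Matrix.GeneralLinearGroup.det (τ g) : (PadicAlgCl ℓ)ˣ) : PadicAlgCl ℓ) • x) → ∃ χ : Literature.NumberTheory.GaloisRepresentations.HeckeCharacter K, χ.IsAlgebraic ∧ ∀ᶠ v : IsDedekindDomain.HeightOneSpectrum (NumberField.RingOfIntegers K) in Filter.cofinite, χ.IsUnramifiedAt v ∧ τ.IsUnramifiedAt v ∧ τ.HasFrobCharpolyAt v (Literature.NumberTheory.Automorphic.arithFrobPolyOfSatake ι v.residueCard 1 ({χ.valueAtUniformizer v} : Multiset ℂ))) → (∀ (K : Type) [Field K] [NumberField K], NumberField.IsCMField K → ∀ (hcpt : Literature.NumberTheory.Automorphic.isCompact_glFiniteIntegralLevel 3 K) (π : Literature.NumberTheory.Automorphic.CuspidalAutomorphicRepData 3 K hcpt), π.1.IsRegularAlgebraic → (∃ η : Literature.NumberTheory.GaloisRepresentations.HeckeCharacter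 K, ∀ᶠ v : IsDedekindDomain.HeightOneSpectrum (NumberField.RingOfIntegers K) in Filter.cofinite, ∀ α : Multiset ℂ, π.1.HasSatakeParamAt v α → η.IsUnramifiedAt v ∧ α.map (fun a => a⁻¹) = α.map (fun a => η.valueAtUniformizer v * a)) → ∀ (hcpt₂ : Literature.NumberTheory.Automorphic.isCompact_glFiniteIntegralLevel 2 K), ∃ σ : Literature.NumberTheory.Automorphic.CuspidalAutomorphicRepData 2 K hcpt₂, σ.1.IsRegularAlgebraic ∧ ∃ ν : Literature.NumberTheory.GaloisRepresentations.HeckeCharacter K, ν.IsAlgebraic ∧ ∀ᶠ v : IsDedekindDomain.HeightOneSpectrum (NumberField.RingOfIntegers K) in Filter.cofinite, ∀ α β : Multiset ℂ, π.1.HasSatakeParamAt v α → σ.1.HasSatakeParamAt v β → ν.IsUnramifiedAt v ∧ α + ({ν.valueAtUniformizer v} : Multiset ℂ) = (Literature.NumberTheory.Automorphic.satakeTensor β (β.map (fun b => b⁻¹))).map (fun c => ν.valueAtUniformizer v * c)) → ∀ (K : Type) [Field K] [NumberField K], NumberField.IsCMField K → ∀ (hcpt : Literature.NumberTheory.Automorphic.isCompact_glFiniteIntegralLevel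 3 K) (π : Literature.NumberTheory.Automorphic.CuspidalAutomorphicRepData 3 K hcpt), π.1.IsRegularAlgebraic → ∀ (ℓ : ℕ) [Fact ℓ.Prime] (ι : PadicAlgCl ℓ ≃+* ℂ) (r : Literature.NumberTheory.GaloisRepresentations.FramedGaloisRep K (PadicAlgCl ℓ) 3), r.toGaloisRep.IsSemisimple → (∀ (v : IsDedekindDomain.HeightOneSpectrum (NumberField.RingOfIntegers K)) (α : Multiset ℂ), π.1.HasSatakeParamAt v α → ((ℓ : ℕ) : NumberField.RingOfIntegers K) ∉ v.asIdeal → r.IsUnramifiedAt v ∧ r.HasFrobCharpolyAt v (Literature.NumberTheory.Automorphic.arithFrobPolyOfSatake ι v.residueCard 3 α)) → (∃ η : Literature.NumberTheory.GaloisRepresentations.HeckeCharacter K, ∀ᶠ v : IsDedekindDomain.HeightOneSpectrum (NumberField.RingOfIntegers K) in Filter.cofinite, ∀ α : Multiset ℂ, π.1.HasSatakeParamAt v α → η.IsUnramifiedAt v ∧ α.map (fun a => a⁻¹) = α.map (fun a => η.valueAtUniformizer v * a)) → r.toGaloisRep.IsIrreducible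

/-- item stmt-Langlands-3186 · crux · rank 3 · closed · moot by None · by planner
why it might fail: BH 3.2.1 prints this for totally real K only. Over CM the summand tau can have half-integral weight relative to pi, so 'L(Alt2 pi x psi1,1) != 0 (Shahidi)' needs tau unitary-normalised first: strict JS bound (tree: only norm_satakeParameter_le_sqrt) or a duality pass; JS (2.2)/(2.3) not antecedents.
sources: arXiv:2404.08954, BockleHui2025, JacquetShalikaAJM1981, JacquetShalikaAJM1981II, ArthurClozelAMS120, ShahidiAJM1981
[crux] (card Steps 0-3 = BH §3.2.1 / Calegari Rem 3.1, made field-independent) given the dictionary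
input (text of AbelianSummandIsHecke): for K totally real or CM, pi regular algebraic cuspidal on
GL_3(A_K), l, iota, r semisimple lang.S27-compatible and NOT irreducible, pi is essentially
self-dual at Satake level: exists a Hecke character eta with, for almost all v and the Satake
parameter alpha_v, eta unramified at v and alpha_v.map inv = alpha_v.map (eta(varpi_v) * .). Proof
line: r = tau + sigma, tau = algebraic Hecke chi (input), JS bounds pin the weight of chi (Step 0),
then zeta(s) L(s, pi^v x omega chi^-2 ...) = L(s, pi x chi^-1 ...) L(s, mu chi^-2) at the unitary
edge forces det sigma = tau^2, i.e. r^v = r x tau^-2, read off on Satake parameters. Expected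
in-tree analytic inputs (to be added as `(h : Fact) ->` antecedents on the prover's request):
JacquetShalika1981_partialPairL_at_one_of_rank_ne / _of_ne_conj / _pole_of_eq_conj,
norm_satakeParameter_le_sqrt, heckeLFunction continuation facts, exists_isAssociatedL2,
hasSatakeParamAt_iff_L2. [deps: AbelianSummandIsHecke] [difficulty: L] -/
@[route_item "route-Langlands-ReducibleSelfDual"]
def ReducibleForcesEssSelfDual : Prop :=
  (∀ (n : ℕ), ∀ (K : Type) [Field K] [NumberField K], (NumberField.IsTotallyReal K ∨ NumberField.IsCMField K) → ∀ (hcpt : Literature.NumberTheory.Automorphic.isCompact_glFiniteIntegralLevel n K) (π : Literature.NumberTheory.Automorphic.CuspidalAutomorphicRepData n K hcpt), π.1.IsRegularAlgebraic → ∀ (ℓ : ℕ) [Fact ℓ.Prime] (ι : PadicAlgCl ℓ ≃+* ℂ) (r : Literature.NumberTheory.GaloisRepresentations.FramedGaloisRep K (PadicAlgCl ℓ) n), r.toGaloisRep.IsSemisimple → (∀ (v : IsDedekindDomain.HeightOneSpectrum (NumberField.RingOfIntegers K)) (α : Multiset ℂ), π.1.HasSatakeParamAt v α → ((ℓ : ℕ)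 : NumberField.RingOfIntegers K) ∉ v.asIdeal → r.IsUnramifiedAt v ∧ r.HasFrobCharpolyAt v (Literature.NumberTheory.Automorphic.arithFrobPolyOfSatake ι v.residueCard n α)) → ∀ (τ : Literature.NumberTheory.GaloisRepresentations.FramedGaloisRep K (PadicAlgCl ℓ) 1), (∃ x : Fin n → PadicAlgCl ℓ, x ≠ 0 ∧ ∀ g : Field.absoluteGaloisGroup K, r.toGaloisRep g x = ((Matrix.GeneralLinearGroup.det (τ g) : (PadicAlgCl ℓ)ˣ) : PadicAlgCl ℓ) • x) → ∃ χ : Literature.NumberTheory.GaloisRepresentations.HeckeCharacter K, χ.IsAlgebraic ∧ ∀ᶠ v : IsDedekindDomain.HeightOneSpectrum (NumberField.RingOfIntegers K) in Filter.cofinite, χ.IsUnramifiedAt v ∧ τ.IsUnramifiedAt v ∧ τ.HasFrobCharpolyAt v (Literature.NumberTheory.Automorphic.arithFrobPolyOfSatake ι v.residueCard 1 ({χ.valueAtUniformizer v} : Multiset ℂ))) → ∀ (K : Type) [Field K] [NumberField K], (NumberField.IsTotallyReal K ∨ NumberField.IsCMField K) → ∀ (hcpt : Literature.NumberTheory.Automorphic.isCompact_glFiniteIntegralLevel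 3 K) (π : Literature.NumberTheory.Automorphic.CuspidalAutomorphicRepData 3 K hcpt), π.1.IsRegularAlgebraic → ∀ (ℓ : ℕ) [Fact ℓ.Prime] (ι : PadicAlgCl ℓ ≃+* ℂ) (r : Literature.NumberTheory.GaloisRepresentations.FramedGaloisRep K (PadicAlgCl ℓ) 3), r.toGaloisRep.IsSemisimple → (∀ (v : IsDedekindDomain.HeightOneSpectrum (NumberField.RingOfIntegers K)) (α : Multiset ℂ), π.1.HasSatakeParamAt v α → ((ℓ : ℕ) : NumberField.RingOfIntegers K) ∉ v.asIdeal → r.IsUnramifiedAt v ∧ r.HasFrobCharpolyAt v (Literature.NumberTheory.Automorphic.arithFrobPolyOfSatake ι v.residueCard 3 α)) → ¬ r.toGaloisRep.IsIrreducible → (∃ η : Literature.NumberTheory.GaloisRepresentations.HeckeCharacter K, ∀ᶠ v : IsDedekindDomain.HeightOneSpectrum (NumberField.RingOfIntegers K) in Filter.cofinite, ∀ α : Multiset ℂ, π.1.HasSatakeParamAt v α → η.IsUnramifiedAt v ∧ α.map (fun a => a⁻¹) = α.map (fun a => η.valueAtUniformizer v * a))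

/-- item stmt-Langlands-3187 · support · rank 4 · closed · moot by None · by planner
why it might fail: Residual risk is formal only: the classification (Ramakrishnan 2014) is not an antecedent as typed, and the Satake identity alpha + {nu} = nu*(beta (x) beta^-1) must match the tree's unitary HasSatakeParamAt normalisation for n=3 and n=2.
sources: Ramakrishnan2014, arXiv:2502.10799, Patrikis2019, arXiv:1207.6724, GelbartJacquet1978, Clozel1990
[crux] (card R1(a)+(b)) for K a CM field and pi regular algebraic cuspidal on GL_3(A_K) essentially
self-dual at Satake level, there are a REGULAR ALGEBRAIC cuspidal sigma on GL_2(A_K) and an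
ALGEBRAIC Hecke character nu with, for almost all v and Satake parameters alpha_v of pi, beta_v =
(a,b) of sigma: nu unramified at v and alpha_v + (nu(varpi_v)) = nu(varpi_v) * (beta_v tensor
beta_v^-1) as multisets (i.e. alpha_v = nu(varpi_v)(a/b, 1, b/a)). Proof line: eta^3 = omega^-2
makes eta a square, so a twist of pi is self-dual with trivial central character; L(s, Sym2) has the
pole; GRS descent to SL_2 + Labesse–Langlands + Gelbart–Jacquet give pi = Ad(sigma0) x nu0
(Ramakrishnan 2014; arXiv:2502.10799 Lem 4.7); purity of pi forces sigma0,w tempered with characters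
(z/|z|)^(m_j) |z|^(i theta_w), m_1 = m_2 mod 2; twisting by a unitary Hecke character with infinity
type |.|^(i theta_w) (admissible because omega_sigma0 is a Hecke character) and by one with infinity
type (z/|z|)^(e_w) (admissible over CM: trivial on totally positive units of K+) makes sigma regular
algebraic; nu is then integral at every place, hence algebraic. [difficulty: M] -/
@[route_item "route-Langlands-ReducibleSelfDual"]
def SelfDualGL3IsAdjointLift : Prop :=
  ∀ (K : Type) [Field K] [NumberField K], NumberField.IsCMField K → ∀ (hcpt : Literature.NumberTheory.Automorphic.isCompact_glFiniteIntegralLevel 3 K) (π : Literature.NumberTheory.Automorphic.CuspidalAutomorphicRepData 3 K hcpt), π.1.IsRegularAlgebraic → (∃ η : Literature.NumberTheory.GaloisRepresentations.HeckeCharacter K, ∀ᶠ v : IsDedekindDomain.HeightOneSpectrum (NumberField.RingOfIntegers K) in Filter.cofinite, ∀ α : Multiset ℂ, π.1.HasSatakeParamAt v α → η.IsUnramifiedAt v ∧ α.map (fun a => a⁻¹) = α.map (fun a => η.valueAtUniformizer v * a)) → ∀ (hcpt₂ : Literature.NumberTheory.Automorphic.isCompact_glFiniteIntegralLevel 2 K),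 ∃ σ : Literature.NumberTheory.Automorphic.CuspidalAutomorphicRepData 2 K hcpt₂, σ.1.IsRegularAlgebraic ∧ ∃ ν : Literature.NumberTheory.GaloisRepresentations.HeckeCharacter K, ν.IsAlgebraic ∧ ∀ᶠ v : IsDedekindDomain.HeightOneSpectrum (NumberField.RingOfIntegers K) in Filter.cofinite, ∀ α β : Multiset ℂ, π.1.HasSatakeParamAt v α → σ.1.HasSatakeParamAt v β → ν.IsUnramifiedAt v ∧ α + ({ν.valueAtUniformizer v} : Multiset ℂ) = (Literature.NumberTheory.Automorphic.satakeTensor β (β.map (fun b => b⁻¹))).map (fun c => ν.valueAtUniformizer v * c)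

/-- item stmt-Langlands-3188 · support · rank 9 · closed · moot by None · by planner
sources: arXiv:2404.08954, Clozel1990, SerreAbelianLadic1968, Henniart 1982 (Représentations l-adiques abéliennes, Sém. Théorie des Nombres Paris), HarrisLanTaylorThorneRMS2016
[support] (printed inputs, transcription) for K totally real or CM, pi regular algebraic cuspidal on
GL_n(A_K), l, iota, r semisimple lang.S27-compatible, every character tau occurring on an r-stable
line is the iota-avatar of an ALGEBRAIC Hecke character chi: for almost all v, chi and tau are
unramified and tau(Frob_v^arith) = iota^-1(chi(varpi_v))^-1 (= arithFrobPolyOfSatake iota q_v 1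
(chi(varpi_v))). = Clozel Thm 3.13 (E-rationality of pi_f) + HLTT/Varma (lg) + Böckle–Hui Thm 1.1
(weak abelian direct summands of E-rational semisimple reps are locally algebraic, ANY number field
K) + Serre Ch. III / Henniart (locally algebraic abelian <=> algebraic Hecke). To be vendored as
Literature named facts and instantiated. [difficulty: M] -/
@[route_item "route-Langlands-ReducibleSelfDual"]
def AbelianSummandIsHecke : Prop :=
  ∀ (n : ℕ), ∀ (K : Type) [Field K] [NumberField K], (NumberField.IsTotallyReal K ∨ NumberField.IsCMField K) → ∀ (hcpt : Literature.NumberTheory.Automorphic.isCompact_glFiniteIntegralLevel n K) (π : Literature.NumberTheory.Automorphic.CuspidalAutomorphicRepData n K hcpt), π.1.IsRegularAlgebraic → ∀ (ℓ : ℕ) [Fact ℓ.Prime] (ι : PadicAlgCl ℓ ≃+* ℂ) (r : Literature.NumberTheory.GaloisRepresentations.FramedGaloisRep K (PadicAlgCl ℓ) n), r.toGaloisRep.IsSemisimple → (∀ (v : IsDedekindDomain.HeightOneSpectrum (NumberField.RingOfIntegers K)) (α : Multiset ℂ), π.1.HasSatakeParamAt v α → ((ℓ : ℕ) : NumberField.RingOfIntegers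 K) ∉ v.asIdeal → r.IsUnramifiedAt v ∧ r.HasFrobCharpolyAt v (Literature.NumberTheory.Automorphic.arithFrobPolyOfSatake ι v.residueCard n α)) → ∀ (τ : Literature.NumberTheory.GaloisRepresentations.FramedGaloisRep K (PadicAlgCl ℓ) 1), (∃ x : Fin n → PadicAlgCl ℓ, x ≠ 0 ∧ ∀ g : Field.absoluteGaloisGroup K, r.toGaloisRep g x = ((Matrix.GeneralLinearGroup.det (τ g) : (PadicAlgCl ℓ)ˣ) : PadicAlgCl ℓ) • x) → ∃ χ : Literature.NumberTheory.GaloisRepresentations.HeckeCharacter K, χ.IsAlgebraic ∧ ∀ᶠ v : IsDedekindDomain.HeightOneSpectrum (NumberField.RingOfIntegers K) in Filter.cofinite, χ.IsUnramifiedAt v ∧ τ.IsUnramifiedAt v ∧ τ.HasFrobCharpolyAt v (Literature.NumberTheory.Automorphic.arithFrobPolyOfSatake ι v.residueCard 1 ({χ.valueAtUniformizer v} : Multiset ℂ))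

/-- item stmt-Langlands-3189 · support · rank 9 · closed · moot by None · by planner
sources: arXiv:2404.08954, doi:10.1007/s00208-025-03252-0
[support] the totally real half of the target: Böckle–Hui Thm 1.2 verbatim (K totally real, pi RA
cuspidal on GL_3, every iota: rho_(pi,iota) irreducible), transported to every semisimple
lang.S27-compatible r by Chebotarev + Brauer–Nesbitt
(FramedGaloisRep.nonempty_equiv_of_hasFrobCharpolyAt_eventually). Known; to be vendored as a named
fact. [difficulty: provable-now] -/
@[route_item "route-Langlands-ReducibleSelfDual"]
def IrreducibleGL3TotallyReal : Prop :=
  ∀ (K : Type) [Field K] [NumberField K], NumberField.IsTotallyReal K → ∀ (hcpt : Literature.NumberTheory.Automorphic.isCompact_glFiniteIntegralLevel 3 K) (π : Literature.NumberTheory.Automorphic.CuspidalAutomorphicRepData 3 K hcpt), π.1.IsRegularAlgebraic → ∀ (ℓ : ℕ) [Fact ℓ.Prime] (ι : PadicAlgCl ℓ ≃+* ℂ) (r : Literature.NumberTheory.GaloisRepresentations.FramedGaloisRep K (PadicAlgCl ℓ) 3), r.toGaloisRep.IsSemisimple → (∀ (v : IsDedekindDomain.HeightOneSpectrum (NumberField.RingOfIntegers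 K)) (α : Multiset ℂ), π.1.HasSatakeParamAt v α → ((ℓ : ℕ) : NumberField.RingOfIntegers K) ∉ v.asIdeal → r.IsUnramifiedAt v ∧ r.HasFrobCharpolyAt v (Literature.NumberTheory.Automorphic.arithFrobPolyOfSatake ι v.residueCard 3 α)) → r.toGaloisRep.IsIrreducible

/-- item stmt-Langlands-3190 · assembly · rank 1 · closed · moot by None · by planner
sources: arXiv:2404.08954, HarrisLanTaylorThorneRMS2016
[assembly] exists_galoisRep_of_regularAlgebraic -> chebotarev_artinRep -> AbelianSummandIsHecke ->
SelfDualGL3IsAdjointLift -> EssSelfDualIrreducible -> ReducibleForcesEssSelfDual ->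
IrreducibleGL3TotallyReal -> IrreducibleGL3. -/
@[route_item "route-Langlands-ReducibleSelfDual"]
def Assembly : Prop :=
  Literature.NumberTheory.Automorphic.exists_galoisRep_of_regularAlgebraic → Literature.NumberTheory.Automorphic.chebotarev_artinRep → AbelianSummandIsHecke → SelfDualGL3IsAdjointLift → EssSelfDualIrreducible → ReducibleForcesEssSelfDual → IrreducibleGL3TotallyReal → IrreducibleGL3

end Summit.Langlands.Langlands.Theses.ReducibleSelfDual
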